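import Literature.Analysis.FluidPDE.PlanarChainCutoffs
import HarnessLib

/-!
# Banded chains: region data and the move of a chain under the order conditions of rectilinear designs

Topic `Literature/Analysis/FluidPDE`. Variant of `PlanarChainCutoffs.WF` / its region data for the
chains that actually occur. The well-formedness `WF` of `PlanarChainCutoffs.lean` asks for the
ORDER condition (`σ_k > 0 ⇒ σ_{k-1} = 1`) on the whole support box of element `k`. With
rectangular box plateaus and axis-aligned junction steps this fails for a CORNER element in the
"inner quadrant" of its box (past the out-junction along the outgoing axis, before the in-junction
along the incoming axis) — a region free of the band, where the cut-offs are irrelevant. The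
order condition is used only (i) at core points of an element to switch off the cut-offs of its
two neighbours, i.e. on the overlap of a support box with a NEIGHBOUR's inner box, and (ii) where
`χ_k Θ_k ≠ 0`, i.e. on the band of element `k`. This file records exactly these conditions
(`ChainData.WFB`: `order_fwd`, `order_bwd` on the overlaps, `order_band` on a closed band
containing the support of `Θ_k`), re-derives the cut-off identities (`WFB.chi_core`,
`WFB.chi_junction` — far neighbours by disjointness alone), the tube property in product form
(`WFB.mem_tubeBox_of_mul_ne_zero`), the region data (`WFB.isRegionData`), and packages the move
of a banded chain: smoothness, incompressibility, transport and the bound on a slot, vanishing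
off the support boxes / off the tubes, identification on cores (`WFB.transport_move`, …) — the
statements a design instantiates.

Folklore; no named facts. Infrastructure towards a discharge of `acm_compatible_blocks`
(`QuasiSelfSimilarCompatibleBlocks.lean`).

## References

* G. Alberti, G. Crippa, A. L. Mazzucato, *Exponential self-similar mixing by incompressible
  flows*, J. Amer. Math. Soc. 32 (2019), 445–490, §§7–8 (arXiv:1605.02090).
-/

noncomputable section

open Function Set Filter
open scoped Topology ContDiff

namespace Literature.Analysis.FluidPDE

namespace PlanarKinematics

/-- The plane `ℝ²` as a Euclidean space. [folklore] -/
local notation "E²" => EuclideanSpace ℝ (Fin 2)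

namespace ChainData

variable (C : ChainData)

/-- **Banded well-formedness of a chain**: positive transition lengths, smooth breakpoints,
disjoint support boxes of non-consecutive elements, the ORDER conditions on the overlaps with
the neighbours' inner boxes (forward: `σ_k = 0 ⇒ σ_{k+1} = 0` on `supp B_{k+1} ∩ inner B_k`;
backward: `σ_k = 1 ⇒ σ_{k-1} = 1` on `supp B_k ∩ inner B_{k+1}`), closed bands, and the order
condition `σ_k > 0 ⇒ σ_{k-1} = 1` on the band of each element. [folklore] -/
structure WFB (Band : ℕ → Set (ℝ × E²)) : Prop where
  /-- plateau transition lengths are positive -/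
  ρ_pos : ∀ k < C.K, 0 < (C.B k).ρ
  /-- breakpoints are smooth -/
  pos_smooth : ∀ j, j + 1 < C.K → ContDiff ℝ ∞ (C.J j).pos
  /-- boxes of non-consecutive elements are disjoint -/
  disjoint : ∀ j < C.K, ∀ k < C.K, j + 2 ≤ k → ∀ z : E², z ∈ (C.B j).supp → z ∉ (C.B k).supp
  /-- forward order on the overlap with the predecessor's inner box -/
  order_fwd : ∀ k, k + 1 < C.K → ∀ (t : ℝ) (z : E²), z ∈ (C.B (k + 1)).supp → z ∈ (C.B k).inner →
    C.sigmaOut k t z = 0 → C.sigmaOut (k + 1) t z = 0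
  /-- backward order on the overlap with the successor's inner box -/
  order_bwd : ∀ k, k + 1 < C.K → ∀ (t : ℝ) (z : E²), z ∈ (C.B k).supp → z ∈ (C.B (k + 1)).inner →
    C.sigmaOut k t z = 1 → C.sigmaIn k t z = 1
  /-- bands are closed -/
  isClosed_band : ∀ k < C.K, IsClosed (Band k)
  /-- order on the band: `σ_k > 0 ⇒ σ_{k-1} = 1` -/
  order_band : ∀ k < C.K, ∀ (t : ℝ) (z : E²), z ∈ (C.B k).supp → (t, z) ∈ Band k →
    0 < C.sigmaOut k t z → C.sigmaIn k t z = 1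

variable {C} {Band : ℕ → Set (ℝ × E²)}

/-- Breakpoints are continuous. [folklore] -/
theorem WFB.pos_continuous (h : C.WFB Band) {j : ℕ} (hj : j + 1 < C.K) : Continuous (C.J j).pos :=
  (h.pos_smooth j hj).continuous

/-- **The cut-offs of a banded chain are smooth.** [folklore] -/
theorem WFB.contDiff_uncurry_chi (h : C.WFB Band) (k : ℕ) : ContDiff ℝ ∞ (uncurry (C.chi k)) := by
  have hτ : ContDiff ℝ ∞ fun p : ℝ × E² => (C.B k).val p.2 := (C.B k).contDiff_val.comp contDiff_snd
  have hout : ∀ m, ContDiff ℝ ∞ (uncurry (C.sigmaOut m)) := by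
    intro m
    unfold sigmaOut
    split_ifs with hm
    · exact (C.J m).contDiff_uncurry_val (h.pos_smooth m hm)
    · exact contDiff_const
  have hin : ContDiff ℝ ∞ (uncurry (C.sigmaIn k)) := by
    unfold sigmaIn
    split_ifs
    · exact contDiff_const
    · exact hout _
  have e : uncurry (C.chi k) = fun p : ℝ × E² =>
      (C.B k).val p.2 * (uncurry (C.sigmaIn k) p - uncurry (C.sigmaOut k) p) := by
    funext p; rfl
  rw [e]
  exact hτ.mul (hin.sub (hout k))

/-- A cut-off outside its support box vanishes. [folklore] -/
theorem WFB.chi_eq_zero_of_not_mem (h : C.WFB Band) {k : ℕ} (hk : k < C.K) {t : ℝ} {z : E²}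
    (hz : z ∉ (C.B k).supp) : C.chi k t z = 0 := by
  rw [chi_apply, (C.B k).val_eq_zero (h.ρ_pos k hk) hz, zero_mul]

/-- Inner boxes lie in support boxes. [folklore] -/
theorem WFB.mem_supp_of_mem_inner (h : C.WFB Band) {k : ℕ} (hk : k < C.K) {z : E²} (hz : z ∈ (C.B k).inner) :
    z ∈ (C.B k).supp := by
  obtain ⟨h1, h2, h3, h4⟩ := hz
  have hρ := h.ρ_pos k hk
  exact ⟨by linarith, by linarith, by linarith, by linarith⟩

/-- **Core identities of a banded chain**: at a point of the inner box of `k` with in-step `1`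
and out-step `0`, `χ_k = 1` and every other cut-off vanishes (neighbours by the order conditions
on the overlaps, the others by disjointness). [folklore] -/
theorem WFB.chi_core (h : C.WFB Band) {k : ℕ} (hk : k < C.K) {t : ℝ} {z : E²} (hz : z ∈ (C.B k).inner)
    (hin : C.sigmaIn k t z = 1) (hout : C.sigmaOut k t z = 0) :
    C.chi k t z = 1 ∧ ∀ j < C.K, j ≠ k → C.chi j t z = 0 := by
  have hzs : z ∈ (C.B k).supp := h.mem_supp_of_mem_inner hk hz
  refine ⟨by rw [chi_apply, (C.B k).val_eq_one (h.ρ_pos k hk) hz, hin, hout]; norm_num, fun j hj hjk => ?_⟩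
  by_cases hzj : z ∈ (C.B j).supp
  · rcases Nat.lt_or_gt_of_ne hjk with hlt | hgt
    · by_cases hj1 : j + 1 = k
      · -- predecessor: its out-step is the in-step of `k`, equal to `1`; backward order
        subst hj1
        rw [sigmaIn_succ] at hin
        rw [chi_apply, h.order_bwd j hk t z hzj hz hin, hin, sub_self, mul_zero]
      · exact absurd hzs (h.disjoint j hj k hk (by omega) z hzj)
    · by_cases hj1 : k + 1 = j
      · -- successor: forward order gives its out-step `0`
        subst hj1
        rw [chi_apply, sigmaIn_succ, hout, h.order_fwd k hj t z hzj hz hout, sub_self, mul_zero]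
      · exact absurd hzj (h.disjoint k hk j hj (by omega) z hzs)
  · exact h.chi_eq_zero_of_not_mem hj hzj

/-- **Junction identities of a banded chain**: at a point of the inner boxes of `k` and `k + 1`
with in-step of `k` equal to `1` and out-step of `k + 1` equal to `0`, `χ_k + χ_{k+1} = 1` and
every other cut-off vanishes (by disjointness alone). [folklore] -/
theorem WFB.chi_junction (h : C.WFB Band) {k : ℕ} (hk : k + 1 < C.K) {t : ℝ} {z : E²}
    (hz : z ∈ (C.B k).inner) (hz' : z ∈ (C.B (k + 1)).inner)
    (hin : C.sigmaIn k t z = 1) (hout : C.sigmaOut (k + 1) t z = 0) :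
    C.chi k t z + C.chi (k + 1) t z = 1 ∧ ∀ j < C.K, j ≠ k → j ≠ k + 1 → C.chi j t z = 0 := by
  have hk' : k < C.K := by omega
  have hzs : z ∈ (C.B k).supp := h.mem_supp_of_mem_inner hk' hz
  have hzs' : z ∈ (C.B (k + 1)).supp := h.mem_supp_of_mem_inner hk hz'
  constructor
  · rw [chi_apply, chi_apply, (C.B k).val_eq_one (h.ρ_pos k hk') hz,
      (C.B (k + 1)).val_eq_one (h.ρ_pos _ hk) hz', hin, sigmaIn_succ, hout]
    ring
  · intro j hj hjk hjk1
    refine h.chi_eq_zero_of_not_mem hj fun hzj => ?_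
    rcases Nat.lt_or_gt_of_ne hjk with hlt | hgt
    · -- `j < k`: `j` and `k + 1` are non-consecutive
      exact h.disjoint j hj (k + 1) hk (by omega) z hzj hzs'
    · -- `j > k + 1`: `k` and `j` are non-consecutive
      have : k + 1 < j := lt_of_le_of_ne (by omega) (Ne.symm hjk1)
      exact h.disjoint k hk' j hj (by omega) z hzs hzj

/-- **Where `χ_k Θ_k` does not vanish** (banded chain, `Θ_k` supported in the band): the point is
in the support box, the in-step is positive and the out-step is below `1`. [folklore] -/
theorem WFB.chi_mul_ne_zero (h : C.WFB Band) {Θ : ℕ → ℝ → E² → ℝ}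
    (hband : ∀ k < C.K, ∀ p : ℝ × E², Θ k p.1 p.2 ≠ 0 → p ∈ Band k) {k : ℕ} (hk : k < C.K) {t : ℝ} {z : E²}
    (hne : C.chi k t z * Θ k t z ≠ 0) :
    z ∈ (C.B k).supp ∧ 0 < C.sigmaIn k t z ∧ C.sigmaOut k t z < 1 ∧ (t, z) ∈ Band k := by
  have hχ : C.chi k t z ≠ 0 := fun e => hne (by rw [e, zero_mul])
  have hΘ : Θ k t z ≠ 0 := fun e => hne (by rw [e, mul_zero])
  have hB : (t, z) ∈ Band k := hband k hk (t, z) hΘ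
  have hzs : z ∈ (C.B k).supp := by
    by_contra hz
    exact hχ (h.chi_eq_zero_of_not_mem hk hz)
  have hdiff : C.sigmaIn k t z ≠ C.sigmaOut k t z := by
    intro e; rw [chi_apply, e, sub_self, mul_zero] at hχ; exact hχ rfl
  refine ⟨hzs, ?_, ?_, hB⟩
  · rcases (C.sigmaIn_mem_Icc k t z).1.lt_or_eq with hpos | h0
    · exact hpos
    · exfalso
      have hout : C.sigmaOut k t z = 0 := by
        by_contra hne'
        have hpos : 0 < C.sigmaOut k t z := lt_of_le_of_ne (C.sigmaOut_mem_Icc k t z).1 (Ne.symm hne')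
        have := h.order_band k hk t z hzs hB hpos
        rw [← h0] at this
        exact zero_ne_one this
      exact hdiff (h0.symm.trans hout.symm)
  · rcases (C.sigmaOut_mem_Icc k t z).2.lt_or_eq with hlt | h1
    · exact hlt
    · exfalso
      exact hdiff ((h.order_band k hk t z hzs hB (by rw [h1]; exact one_pos)).trans h1.symm)

/-- **`χ_k Θ_k ≠ 0` only on the tube box ∩ band.** [folklore] -/
theorem WFB.mem_tubeBox_of_mul_ne_zero (h : C.WFB Band) {Θ : ℕ → ℝ → E² → ℝ}
    (hband : ∀ k < C.K, ∀ p : ℝ × E², Θ k p.1 p.2 ≠ 0 → p ∈ Band k) {k : ℕ} (hk : k < C.K) {p : ℝ × E²}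
    (hne : C.chi k p.1 p.2 * Θ k p.1 p.2 ≠ 0) : p ∈ C.tubeBox k ∩ Band k := by
  obtain ⟨hzs, hin, hout, hB⟩ := h.chi_mul_ne_zero hband hk hne
  refine ⟨⟨⟨hzs, ?_⟩, fun hk1 => ?_⟩, hB⟩
  · by_cases h0 : k = 0
    · exact Or.inl h0
    · right
      unfold sigmaIn at hin
      rw [if_neg h0] at hin
      unfold sigmaOut at hin
      rw [if_pos (by omega)] at hin
      exact ((C.J (k - 1)).arg_gt_of_val_pos hin).le
  · unfold sigmaOut at hout
    rw [if_pos hk1] at hout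
    exact ((C.J k).arg_lt_of_val_lt_one hout).le

/-- The core region of a banded chain is open. [folklore] -/
theorem WFB.isOpen_core (h : C.WFB Band) {k : ℕ} (hk : k < C.K) : IsOpen (C.core k) := by
  refine ((isOpen_univ_prod (C.B k).isOpen_inner).inter ?_).inter ?_
  · by_cases h0 : k = 0
    · convert isOpen_univ (X := ℝ × E²); ext p; simp [inOne, h0]
    · have hop := (C.J (k - 1)).isOpen_arg_gt (h.pos_continuous (j := k - 1) (by omega)) (2 / 3)
      convert hop using 1; ext p; simp [inOne, h0]
  · by_cases hk1 : k + 1 < C.K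
    · have hop := (C.J k).isOpen_arg_lt (h.pos_continuous hk1) (1 / 3)
      convert hop using 1; ext p; simp [outZero, hk1]
    · convert isOpen_univ (X := ℝ × E²); ext p; simp [outZero, hk1]

/-- The junction region of a banded chain is open. [folklore] -/
theorem WFB.isOpen_juncCut (h : C.WFB Band) {k : ℕ} (hk : k + 1 < C.K) : IsOpen (C.juncCut k) := by
  refine ((isOpen_univ_prod ((C.B k).isOpen_inner.inter (C.B (k + 1)).isOpen_inner)).inter ?_).inter ?_
  · by_cases h0 : k = 0
    · convert isOpen_univ (X := ℝ × E²); ext p; simp [inOne, h0]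
    · have hop := (C.J (k - 1)).isOpen_arg_gt (h.pos_continuous (j := k - 1) (by omega)) (2 / 3)
      convert hop using 1; ext p; simp [inOne, h0]
  · by_cases hk2 : k + 2 < C.K
    · have hop := (C.J (k + 1)).isOpen_arg_lt (h.pos_continuous hk2) (1 / 3)
      convert hop using 1; ext p; simp [outZero, hk2]
    · convert isOpen_univ (X := ℝ × E²); ext p; simp [outZero, hk2]

/-- The tube box of a banded chain is closed. [folklore] -/
theorem WFB.isClosed_tubeBox (h : C.WFB Band) {k : ℕ} (hk : k < C.K) : IsClosed (C.tubeBox k) := by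
  refine ((isClosed_univ_prod (C.B k).isClosed_supp).inter ?_).inter ?_
  · by_cases h0 : k = 0
    · convert isClosed_univ (X := ℝ × E²); ext p; simp [h0]
    · have hcl := (C.J (k - 1)).isClosed_arg_ge (h.pos_continuous (j := k - 1) (by omega)) (1 / 3)
      convert hcl using 1; ext p; simp [h0]
  · by_cases hk1 : k + 1 < C.K
    · have hcl := (C.J k).isClosed_arg_le (h.pos_continuous hk1) (2 / 3)
      convert hcl using 1; ext p; simp [hk1]
    · convert isClosed_univ (X := ℝ × E²); ext p; simp [hk1]

/-! ## Region data and the move of a banded chain -/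

section Move

variable {Θ H : ℕ → ℝ → E² → ℝ} {Agree : ℕ → Set (ℝ × E²)} {S : Set ℝ} {Q : Set E²} {H₀ M : ℝ}

/-- **Region data from a banded chain**: with the bands of `WFB` containing the supports of the
`Θ_k`, open agreement regions on which consecutive elements coincide, and the per-element cover,
the families `(χ, Θ, H)` carry region data. [folklore] -/
theorem WFB.isRegionData (h : C.WFB Band)
    (hband : ∀ k < C.K, ∀ p : ℝ × E², Θ k p.1 p.2 ≠ 0 → p ∈ Band k)
    (hAo : ∀ k, k + 1 < C.K → IsOpen (Agree k))
    (hAΘ : ∀ k, k + 1 < C.K → ∀ p ∈ Agree k, Θ (k + 1) p.1 p.2 = Θ k p.1 p.2)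
    (hAH : ∀ k, k + 1 < C.K → ∀ p ∈ Agree k, H (k + 1) p.1 p.2 = H k p.1 p.2)
    (hcover : ∀ t ∈ S, ∀ z ∈ Q, ∀ k < C.K, (t, z) ∈ C.tubeBox k ∩ Band k →
      (t, z) ∈ C.core k ∨ (0 < k ∧ (t, z) ∈ C.juncCut (k - 1) ∩ Agree (k - 1)) ∨
        (k + 1 < C.K ∧ (t, z) ∈ C.juncCut k ∩ Agree k)) :
    IsRegionData C.K C.chi Θ H C.core (fun k => C.juncCut k ∩ Agree k) (fun k => C.tubeBox k ∩ Band k) S Q where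
  isOpen_core k hk := h.isOpen_core hk
  isOpen_junc k hk := (h.isOpen_juncCut hk).inter (hAo k hk)
  isClosed_tube j hj := (h.isClosed_tubeBox hj).inter (h.isClosed_band j hj)
  core_one k hk p hp :=
    (h.chi_core hk hp.1.1 (C.sigmaIn_eq_one_of_mem hk hp.1.2) (C.sigmaOut_eq_zero_of_mem hp.2)).1
  core_zero k hk p hp j hj hjk :=
    (h.chi_core hk hp.1.1 (C.sigmaIn_eq_one_of_mem hk hp.1.2) (C.sigmaOut_eq_zero_of_mem hp.2)).2 j hj hjk
  junc_sum k hk p hp :=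
    (h.chi_junction hk hp.1.1.1.1 hp.1.1.1.2 (C.sigmaIn_eq_one_of_mem (by omega) hp.1.1.2)
      (C.sigmaOut_eq_zero_of_mem hp.1.2)).1
  junc_zero k hk p hp j hj hjk hjk1 :=
    (h.chi_junction hk hp.1.1.1.1 hp.1.1.1.2 (C.sigmaIn_eq_one_of_mem (by omega) hp.1.1.2)
      (C.sigmaOut_eq_zero_of_mem hp.1.2)).2 j hj hjk hjk1
  junc_scalar k hk p hp := hAΘ k hk p hp.2
  junc_stream k hk p hp := hAH k hk p hp.2
  tube j hj p hne := h.mem_tubeBox_of_mul_ne_zero hband hj hne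
  cover t ht z hz hex := by
    obtain ⟨j, hj, hmem⟩ := hex
    rcases hcover t ht z hz j hj hmem with hc | ⟨hj0, hju⟩ | ⟨hj1, hju⟩
    · exact Or.inl ⟨j, hj, hc⟩
    · exact Or.inr ⟨j - 1, by omega, by
        have e : j - 1 + 1 = j := by omega
        simpa only using hju⟩
    · exact Or.inr ⟨j, hj1, hju⟩

/-- **Element facts for a banded chain**: joint smoothness, transport of each `Θ_k` by `∇⊥H_k`
everywhere, the uniform bound, and containment of the support of `Θ_k` in the band. [folklore] -/
structure BandedFacts (C : ChainData) (Θ H : ℕ → ℝ → E² → ℝ) (M : ℝ) (Band : ℕ → Set (ℝ × E²)) : Prop where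
  /-- `Θ_k ∈ C^∞(ℝ × ℝ²)` -/
  smooth_scalar : ∀ k < C.K, ContDiff ℝ ∞ (uncurry (Θ k))
  /-- `H_k ∈ C^∞(ℝ × ℝ²)` -/
  smooth_stream : ∀ k < C.K, ContDiff ℝ ∞ (uncurry (H k))
  /-- `Θ_k` is transported by `∇⊥H_k` everywhere -/
  transport : ∀ k < C.K, ∀ (t : ℝ) (z : E²),
    deriv (fun s => Θ k s z) t + fderiv ℝ (Θ k t) z (perpGrad (H k t) z) = 0
  /-- `|Θ_k| ≤ M` -/
  abs_le : ∀ k < C.K, ∀ (t : ℝ) (z : E²), |Θ k t z| ≤ M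
  /-- the bound is nonnegative -/
  M_nonneg : 0 ≤ M
  /-- `Θ_k ≠ 0` only on the band -/
  band : ∀ k < C.K, ∀ p : ℝ × E², Θ k p.1 p.2 ≠ 0 → p ∈ Band k

/-- **Junction agreement** for a banded chain. [folklore] -/
structure BandedAgreement (C : ChainData) (Θ H : ℕ → ℝ → E² → ℝ) (Agree : ℕ → Set (ℝ × E²)) : Prop where
  /-- agreement regions are open -/
  isOpen : ∀ k, k + 1 < C.K → IsOpen (Agree k)
  /-- scalars agree -/
  scalar : ∀ k, k + 1 < C.K → ∀ p ∈ Agree k, Θ (k + 1) p.1 p.2 = Θ k p.1 p.2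
  /-- stream functions agree -/
  stream : ∀ k, k + 1 < C.K → ∀ p ∈ Agree k, H (k + 1) p.1 p.2 = H k p.1 p.2

/-- **The assembled scalar of a banded chain is smooth.** [folklore] -/
theorem WFB.contDiff_uncurry_scalar (h : C.WFB Band) (hE : BandedFacts C Θ H M Band) :
    ContDiff ℝ ∞ (uncurry (assembledScalar C.K C.chi Θ)) :=
  contDiff_uncurry_assembledScalar C.K C.chi Θ (fun k _ => h.contDiff_uncurry_chi k) hE.smooth_scalar

/-- **The assembled stream function of a banded chain is smooth.** [folklore] -/
theorem WFB.contDiff_uncurry_stream (h : C.WFB Band) (hE : BandedFacts C Θ H M Band) :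
    ContDiff ℝ ∞ (uncurry (assembledStream C.K H₀ C.chi H)) :=
  contDiff_uncurry_assembledStream C.K H₀ C.chi H (fun k _ => h.contDiff_uncurry_chi k) hE.smooth_stream

/-- **The assembled velocity of a banded chain is smooth.** [folklore] -/
theorem WFB.contDiff_uncurry_velocity (h : C.WFB Band) (hE : BandedFacts C Θ H M Band) :
    ContDiff ℝ ∞ (uncurry (assembledVelocity C.K H₀ C.chi H)) :=
  contDiff_uncurry_assembledVelocity C.K H₀ C.chi H (fun k _ => h.contDiff_uncurry_chi k) hE.smooth_stream

/-- **The assembled velocity of a banded chain is divergence free everywhere.** [folklore] -/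
theorem WFB.divergence_velocity (h : C.WFB Band) (hE : BandedFacts C Θ H M Band) (t : ℝ) (z : E²) :
    ∑ j, fderiv ℝ (assembledVelocity C.K H₀ C.chi H t) z (EuclideanSpace.single j 1) j = 0 :=
  divergence_assembledVelocity C.K H₀ C.chi H (fun k _ => h.contDiff_uncurry_chi k) hE.smooth_stream t z

/-- **Transport of the move of a banded chain on `S × Q`.** [folklore] -/
theorem WFB.transport_move (h : C.WFB Band) (hE : BandedFacts C Θ H M Band) (hA : BandedAgreement C Θ H Agree)
    (hcover : ∀ t ∈ S, ∀ z ∈ Q, ∀ k < C.K, (t, z) ∈ C.tubeBox k ∩ Band k →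
      (t, z) ∈ C.core k ∨ (0 < k ∧ (t, z) ∈ C.juncCut (k - 1) ∩ Agree (k - 1)) ∨
        (k + 1 < C.K ∧ (t, z) ∈ C.juncCut k ∩ Agree k)) :
    ∀ t ∈ S, ∀ z ∈ Q, deriv (fun s => assembledScalar C.K C.chi Θ s z) t +
      fderiv ℝ (assembledScalar C.K C.chi Θ t) z (assembledVelocity C.K H₀ C.chi H t z) = 0 :=
  transport_assembled_of_regions
    (h.isRegionData hE.band hA.isOpen hA.scalar hA.stream hcover) fun k hk t _ z _ => hE.transport k hk t z

/-- **The bound of the move of a banded chain on `S × Q`.** [folklore] -/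
theorem WFB.abs_scalar_le (h : C.WFB Band) (hE : BandedFacts C Θ H M Band) (hA : BandedAgreement C Θ H Agree)
    (hcover : ∀ t ∈ S, ∀ z ∈ Q, ∀ k < C.K, (t, z) ∈ C.tubeBox k ∩ Band k →
      (t, z) ∈ C.core k ∨ (0 < k ∧ (t, z) ∈ C.juncCut (k - 1) ∩ Agree (k - 1)) ∨
        (k + 1 < C.K ∧ (t, z) ∈ C.juncCut k ∩ Agree k)) :
    ∀ t ∈ S, ∀ z ∈ Q, |assembledScalar C.K C.chi Θ t z| ≤ M :=
  abs_assembledScalar_le_of_regions (h.isRegionData hE.band hA.isOpen hA.scalar hA.stream hcover) hE.M_nonneg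
    fun k hk t _ z _ => hE.abs_le k hk t z

/-- **The assembled velocity of a banded chain vanishes off the support boxes**: at a point `z`
outside every support box (e.g. on the boundary strips of the square away from the gate windows)
the stream function is locally the background constant. [folklore] -/
theorem WFB.velocity_eq_zero_off_boxes (h : C.WFB Band) {t : ℝ} {z : E²} (hz : ∀ k < C.K, z ∉ (C.B k).supp) :
    assembledVelocity C.K H₀ C.chi H t z = 0 :=
  assembledVelocity_eq_zero_off_streamTubes (TubeH := fun k => {p : ℝ × E² | p.2 ∈ (C.B k).supp})
    (fun k _ => isClosed_univ_prod (C.B k).isClosed_supp)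
    (fun k hk p hne => by
      by_contra hp
      exact hne (by rw [h.chi_eq_zero_of_not_mem hk hp, zero_mul]))
    fun k hk hmem => hz k hk hmem

/-- **The assembled scalar of a banded chain vanishes off the support boxes.** [folklore] -/
theorem WFB.scalar_eq_zero_off_boxes (h : C.WFB Band) {t : ℝ} {z : E²} (hz : ∀ k < C.K, z ∉ (C.B k).supp) :
    assembledScalar C.K C.chi Θ t z = 0 := by
  rw [assembledScalar_apply]
  exact Finset.sum_eq_zero fun k hk => by
    rw [h.chi_eq_zero_of_not_mem (Finset.mem_range.1 hk) (hz k (Finset.mem_range.1 hk)), zero_mul]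

/-- **The assembled scalar of a banded chain vanishes off the tubes** (tube box ∩ band). [folklore] -/
theorem WFB.scalar_eq_zero_off_tubes (h : C.WFB Band) (hE : BandedFacts C Θ H M Band) {t : ℝ} {z : E²}
    (hz : ∀ k < C.K, (t, z) ∉ C.tubeBox k ∩ Band k) : assembledScalar C.K C.chi Θ t z = 0 :=
  assembledScalar_eq_zero_off_tubes (Tube := fun k => C.tubeBox k ∩ Band k)
    (fun _ hk _ hne => h.mem_tubeBox_of_mul_ne_zero hE.band hk hne) hz

/-- **On the core of an element the move of a banded chain is that element.** [folklore] -/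
theorem WFB.move_eq_of_core (h : C.WFB Band) {k : ℕ} (hk : k < C.K) {t : ℝ} {z : E²} (hp : (t, z) ∈ C.core k) :
    assembledScalar C.K C.chi Θ t z = Θ k t z ∧ assembledVelocity C.K H₀ C.chi H t z = perpGrad (H k t) z := by
  have hopen := h.isOpen_core hk
  have h1 : ∀ᶠ p in 𝓝 (t, z), C.chi k p.1 p.2 = 1 :=
    eventually_of_mem_open (P := fun s w => C.chi k s w = 1) hopen hp fun p hp' =>
      (h.chi_core hk hp'.1.1 (C.sigmaIn_eq_one_of_mem hk hp'.1.2) (C.sigmaOut_eq_zero_of_mem hp'.2)).1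
  have h0 : ∀ j < C.K, j ≠ k → ∀ᶠ p in 𝓝 (t, z), C.chi j p.1 p.2 = 0 := fun j hj hjk =>
    eventually_of_mem_open (P := fun s w => C.chi j s w = 0) hopen hp fun p hp' =>
      (h.chi_core hk hp'.1.1 (C.sigmaIn_eq_one_of_mem hk hp'.1.2) (C.sigmaOut_eq_zero_of_mem hp'.2)).2 j hj hjk
  exact assembled_eq_prescribed_of_core (Θg := Θ k) (Hg := H k) hk h1 h0 (Eventually.of_forall fun _ => rfl)
    (Eventually.of_forall fun _ => rfl)

/-- **Agreement with a prescribed pair on a core** (gate windows). [folklore] -/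
theorem WFB.move_eq_prescribed_of_core (h : C.WFB Band) {k : ℕ} (hk : k < C.K) {Θg Hg : ℝ → E² → ℝ}
    (hΘ : ∀ p ∈ C.core k, Θ k p.1 p.2 = Θg p.1 p.2) (hH : ∀ p ∈ C.core k, H k p.1 p.2 = Hg p.1 p.2)
    {t : ℝ} {z : E²} (hp : (t, z) ∈ C.core k) :
    assembledScalar C.K C.chi Θ t z = Θg t z ∧ assembledVelocity C.K H₀ C.chi H t z = perpGrad (Hg t) z := by
  have hopen := h.isOpen_core hk
  have h1 : ∀ᶠ p in 𝓝 (t, z), C.chi k p.1 p.2 = 1 :=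
    eventually_of_mem_open (P := fun s w => C.chi k s w = 1) hopen hp fun p hp' =>
      (h.chi_core hk hp'.1.1 (C.sigmaIn_eq_one_of_mem hk hp'.1.2) (C.sigmaOut_eq_zero_of_mem hp'.2)).1
  have h0 : ∀ j < C.K, j ≠ k → ∀ᶠ p in 𝓝 (t, z), C.chi j p.1 p.2 = 0 := fun j hj hjk =>
    eventually_of_mem_open (P := fun s w => C.chi j s w = 0) hopen hp fun p hp' =>
      (h.chi_core hk hp'.1.1 (C.sigmaIn_eq_one_of_mem hk hp'.1.2) (C.sigmaOut_eq_zero_of_mem hp'.2)).2 j hj hjk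
  exact assembled_eq_prescribed_of_core hk h1 h0
    (eventually_of_mem_open (P := fun s w => Θ k s w = Θg s w) hopen hp hΘ)
    (eventually_of_mem_open (P := fun s w => H k s w = Hg s w) hopen hp hH)

end Move

end ChainData

end PlanarKinematics

end Literature.Analysis.FluidPDE
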